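import Mathlib.Analysis.InnerProductSpace.Spectrum
import Mathlib.Analysis.InnerProductSpace.l2Space
import Mathlib.Analysis.InnerProductSpace.Adjoint
import HarnessLib

/-!
# A compact self-adjoint operator has a Hilbert basis of eigenvectors

Topic `Literature/Analysis/OperatorTheory` (next to `CompactSelfAdjointResolvent.lean`). Mathlib (this
pin) proves the spectral theorem for a compact symmetric operator `T` on a Hilbert space in the form
"the eigenspaces are total", `(⨆ μ, eigenspace T μ)ᗮ = ⊥`
(`ContinuousLinearMap.orthogonalComplement_iSup_eigenspaces_eq_bot`), together with their mutual
orthogonality (`LinearMap.IsSymmetric.orthogonalFamily_eigenspaces`) and the finite dimension of the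
non-zero ones. This file assembles the classical statement (Hilbert–Schmidt; Reed–Simon I,
Thm. VI.16: *"there is a complete orthonormal basis `{φₙ}` for `ℋ` so that `Aφₙ = λₙφₙ`"*): there is a
Hilbert basis of `E` consisting of eigenvectors of `T`, with real eigenvalues,

  `exists_hilbertBasis_eigenvectors :
     ∃ (s : Set E) (b : HilbertBasis s 𝕜 E) (κ : s → ℝ), ⇑b = (↑) ∧ ∀ i, T (b i) = (κ i : 𝕜) • b i`.

Construction: choose a Hilbert basis of every eigenspace (a closed subspace, hence complete;
Mathlib's `exists_hilbertBasis`), take the union `s` of their images in `E`; it is orthonormal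
(inside one eigenspace by construction, across eigenspaces by orthogonality), and a vector
orthogonal to `s` is orthogonal to every eigenspace (expand along the chosen basis), hence to their
supremum, hence zero — so `s` is a Hilbert basis by `HilbertBasis.mkOfOrthogonalEqBot`.

This is the entrance to min–max / Ky Fan statements for operators with compact resolvent
(`Literature/Analysis/InnerProduct/KyFanOrthonormal.lean`, `…/UnboundedOperators/KyFanDiagonalOperator.lean`:
in such a basis `(T + c)⁻¹`, and hence `T`, is a diagonal operator). No definitions, no named facts.

## References

* M. Reed, B. Simon, *Methods of Modern Mathematical Physics I: Functional Analysis* (1980),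
  Thm. VI.16 (Hilbert–Schmidt theorem). [ReedSimonI1980]
* F. Riesz, B. Sz.-Nagy, *Functional Analysis* (1955), §93.
-/

noncomputable section

open scoped InnerProductSpace ComplexConjugate
open Submodule Module.End

namespace Literature.Analysis.OperatorTheory

variable {𝕜 E : Type*} [RCLike 𝕜] [NormedAddCommGroup E] [InnerProductSpace 𝕜 E]

/-- The eigenspaces of a bounded operator are closed (the equaliser of `T` and `μ • id`).
[folklore] -/
theorem isClosed_eigenspace (T : E →L[𝕜] E) (μ : 𝕜) :
    IsClosed ((eigenspace (T : Module.End 𝕜 E) μ : Submodule 𝕜 E) : Set E) := by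
  have h : ((eigenspace (T : Module.End 𝕜 E) μ : Submodule 𝕜 E) : Set E) = {x | T x = μ • x} := by
    ext x
    simp
  rw [h]
  exact isClosed_eq T.continuous (continuous_id.const_smul μ)

variable [CompleteSpace E]

/-- **Hilbert–Schmidt theorem (spectral theorem for compact self-adjoint operators), Hilbert-basis
form.** A compact symmetric bounded operator `T` on a Hilbert space over `ℝ` or `ℂ` admits a Hilbert
basis of `E` consisting of eigenvectors of `T` with real eigenvalues: there are a set `s ⊆ E`, a
Hilbert basis `b` indexed by `s` with `b i = i`, and `κ : s → ℝ` with `T (b i) = κ i • b i`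
(Reed–Simon I, Thm. VI.16). Assembled from Mathlib's totality of the eigenspaces
(`ContinuousLinearMap.orthogonalComplement_iSup_eigenspaces_eq_bot`) by choosing a Hilbert basis in
each (closed) eigenspace. [cite: ReedSimonI1980, Thm. VI.16] -/
theorem exists_hilbertBasis_eigenvectors {T : E →L[𝕜] E} (hT : IsCompactOperator T)
    (hT' : (T : E →ₗ[𝕜] E).IsSymmetric) :
    ∃ (s : Set E) (b : HilbertBasis s 𝕜 E) (κ : s → ℝ),
      ⇑b = ((↑) : s → E) ∧ ∀ i, T (b i) = ((κ i : ℝ) : 𝕜) • b i := by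
  classical
  -- a Hilbert basis `bV μ` (indexed by a subset `w μ`) of each eigenspace `eigenspace T μ`
  have hVb : ∀ μ : 𝕜, ∃ (w : Set (eigenspace (T : Module.End 𝕜 E) μ))
      (b : HilbertBasis w 𝕜 (eigenspace (T : Module.End 𝕜 E) μ)),
      ⇑b = ((↑) : w → eigenspace (T : Module.End 𝕜 E) μ) :=
    fun μ => by
      haveI : CompleteSpace (eigenspace (T : Module.End 𝕜 E) μ) :=
        (isClosed_eigenspace T μ).completeSpace_coe
      exact exists_hilbertBasis 𝕜 (eigenspace (T : Module.End 𝕜 E) μ)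
  choose w bV hbV using hVb
  -- the candidate basis: the union of their images in `E`
  let s : Set E := ⋃ μ, ((↑) : eigenspace (T : Module.End 𝕜 E) μ → E) '' (w μ)
  have hmem : ∀ {x : E}, x ∈ s →
      ∃ μ, ∃ y : eigenspace (T : Module.End 𝕜 E) μ, y ∈ w μ ∧ (y : E) = x := fun hx => by
    obtain ⟨μ, hμ⟩ := Set.mem_iUnion.1 hx
    obtain ⟨y, hy, rfl⟩ := hμ
    exact ⟨μ, y, hy, rfl⟩
  -- basis vectors of `eigenspace T μ` are unit vectors
  have hnorm : ∀ μ, ∀ y : eigenspace (T : Module.End 𝕜 E) μ, y ∈ w μ → ‖(y : E)‖ = 1 :=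
      fun μ y hy => by
    have h1 := (bV μ).orthonormal.1 ⟨y, hy⟩
    rw [hbV μ] at h1
    simpa using h1
  -- inner products inside one eigenspace
  have hsame : ∀ μ, ∀ y y' : eigenspace (T : Module.End 𝕜 E) μ, y ∈ w μ → y' ∈ w μ →
      ⟪(y : E), (y' : E)⟫_𝕜 = if y = y' then 1 else 0 := fun μ y y' hy hy' => by
    have h := (bV μ).orthonormal
    rw [hbV μ, orthonormal_subtype_iff_ite] at h
    rw [← Submodule.coe_inner]
    exact h y hy y' hy'
  -- orthonormality of `s`
  have hon : Orthonormal 𝕜 ((↑) : s → E) := by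
    rw [orthonormal_subtype_iff_ite]
    intro v hv v' hv'
    obtain ⟨μ, y, hy, rfl⟩ := hmem hv
    obtain ⟨μ', y', hy', rfl⟩ := hmem hv'
    by_cases hμ : μ = μ'
    · subst hμ
      rw [hsame μ y y' hy hy']
      by_cases hyy : y = y'
      · subst hyy; simp
      · have : (y : E) ≠ (y' : E) := fun h => hyy (Subtype.ext h)
        simp [hyy, this]
    · -- distinct eigenvalues: orthogonal eigenvectors, hence also distinct vectors
      have horth : ⟪(y : E), (y' : E)⟫_𝕜 = 0 := hT'.orthogonalFamily_eigenspaces hμ y y'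
      have hne : (y : E) ≠ (y' : E) := by
        intro h
        have h0 : ⟪(y : E), (y : E)⟫_𝕜 = 0 := by
          have h' := horth
          rwa [← h] at h'
        rw [inner_self_eq_zero] at h0
        have := hnorm μ y hy
        rw [h0, norm_zero] at this
        exact zero_ne_one this
      simp [hne, horth]
  -- totality: a vector orthogonal to `s` is orthogonal to every eigenspace, hence zero
  have hbot : (span 𝕜 (Set.range ((↑) : s → E)))ᗮ = ⊥ := by
    rw [Submodule.eq_bot_iff]
    intro z hz
    have hzV : ∀ μ, z ∈ (eigenspace (T : Module.End 𝕜 E) μ)ᗮ := by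
      intro μ
      rw [Submodule.mem_orthogonal]
      intro x hx
      -- expand `x ∈ eigenspace T μ` along the Hilbert basis `bV μ` and pair with `z`
      set L : eigenspace (T : Module.End 𝕜 E) μ →L[𝕜] 𝕜 :=
        (innerSL 𝕜 z).comp (eigenspace (T : Module.End 𝕜 E) μ).subtypeL with hL
      have hsum := ((bV μ).hasSum_repr ⟨x, hx⟩).mapL L
      have hzero : ∀ i : w μ, L ((bV μ).repr ⟨x, hx⟩ i • (bV μ) i) = 0 := by
        intro i
        simp only [hL, ContinuousLinearMap.coe_comp, Function.comp_apply, Submodule.subtypeL_apply,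
          Submodule.coe_smul, innerSL_apply_apply, inner_smul_right]
        have hi : ((bV μ i : eigenspace (T : Module.End 𝕜 E) μ) : E) ∈
            span 𝕜 (Set.range ((↑) : s → E)) := by
          refine Submodule.subset_span
            ⟨⟨((bV μ i : eigenspace (T : Module.End 𝕜 E) μ) : E), ?_⟩, rfl⟩
          refine Set.mem_iUnion.2 ⟨μ, ⟨bV μ i, ?_, rfl⟩⟩
          rw [hbV μ]
          exact i.2
        have := (Submodule.mem_orthogonal _ _).1 hz _ hi
        rw [inner_eq_zero_symm] at this
        rw [this, mul_zero]
      simp only [hzero] at hsum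
      have h0 : L ⟨x, hx⟩ = 0 := hsum.unique hasSum_zero
      simp only [hL, ContinuousLinearMap.coe_comp, Function.comp_apply, Submodule.subtypeL_apply,
        innerSL_apply_apply] at h0
      rw [inner_eq_zero_symm] at h0
      exact h0
    have hz' : z ∈ (⨆ μ, eigenspace (T : Module.End 𝕜 E) μ)ᗮ := by
      rw [← Submodule.iInf_orthogonal]
      exact (Submodule.mem_iInf _).2 hzV
    rw [ContinuousLinearMap.orthogonalComplement_iSup_eigenspaces_eq_bot hT hT'] at hz'
    exact (Submodule.mem_bot 𝕜).1 hz'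
  -- assemble
  refine ⟨s, HilbertBasis.mkOfOrthogonalEqBot hon hbot, fun i => RCLike.re (Classical.choose
    (hmem i.2)), HilbertBasis.coe_mkOfOrthogonalEqBot hon hbot, fun i => ?_⟩
  rw [HilbertBasis.coe_mkOfOrthogonalEqBot]
  set μ := Classical.choose (hmem i.2) with hμdef
  obtain ⟨y, hy, hyi⟩ := Classical.choose_spec (hmem i.2)
  -- `i = y ∈ eigenspace (T : Module.End 𝕜 E) μ`, a unit vector: `T i = μ i` with `μ` real
  have hiV : (i : E) ∈ eigenspace (T : Module.End 𝕜 E) μ := by rw [← hyi]; exact y.2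
  have hTi : T (i : E) = μ • (i : E) := mem_eigenspace_iff.1 hiV
  have hi0 : (i : E) ≠ 0 := by
    intro h
    have := hnorm μ y hy
    rw [hyi, h, norm_zero] at this
    exact zero_ne_one this
  have hreal : conj μ = μ :=
    hT'.conj_eigenvalue_eq_self (hasEigenvalue_of_hasEigenvector ⟨hiV, hi0⟩)
  rw [hTi, RCLike.conj_eq_iff_re.1 hreal]

/-- **Hilbert basis of eigenvectors for a compact self-adjoint operator** (`IsSelfAdjoint` form of
`exists_hilbertBasis_eigenvectors`; Reed–Simon I, Thm. VI.16). [cite: ReedSimonI1980, Thm. VI.16] -/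
theorem exists_hilbertBasis_eigenvectors_of_isSelfAdjoint {T : E →L[𝕜] E}
    (hT : IsCompactOperator T) (hsa : IsSelfAdjoint T) :
    ∃ (s : Set E) (b : HilbertBasis s 𝕜 E) (κ : s → ℝ),
      ⇑b = ((↑) : s → E) ∧ ∀ i, T (b i) = ((κ i : ℝ) : 𝕜) • b i :=
  exists_hilbertBasis_eigenvectors hT hsa.isSymmetric

end Literature.Analysis.OperatorTheory

end
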